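import Summits.PneNP.PneNP.Theorems.ReslinSizeFromWidthPCDegreeGOP
import Literature.Computability.MetaComplexity.GraphOrderingPrincipleDegreeProof
import HarnessLib

/-!
# PneNP / ReslinSizeFromWidth — the PC rail's first PROVED input: graph ordering principles (unconditional)

Helper file for the INPUT side of crux `ResLinSizeFromWidth` (stmt-PneNP-18932).
`ReslinSizeFromWidthPCDegreeGOP.lean` fed Galesi–Lauria's degree lower bound for `GOP(G)`
(ACM ToCL 2010, Thm 1) into the PC rail as a NAMED FACT `hGL : GalesiLauria2010_PC_GOP_degree`;
that fact is now DISCHARGED in the tree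
(`Literature/…/GraphOrderingPrincipleDegreeProof.lean`: `GalesiLauria2010_PC_GOP_degree_holds`, a
kernel-checked reproduction of GL10 §2.1, §3).  This file records the UNCONDITIONAL corollaries —
the first Res(⊕) width / space / tree-like-size lower bounds in the tree for a natural
bounded-width CNF family obtained through polynomial-calculus degree ("All previously known lower
bounds on width/rank were based on polynomial calculus degree lower bounds", Efremenko–Garlík–
Itsykson 2024): for `G` on `Fin n` an `(r, c)`-vertex expander (`r ≥ 1`, `c > 0`),

* `¬ PC.RefutableInDegree (cnfPolys (ZMod 2) (GOP.glGOP G)) d` for `d ≤ cr/4`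
  (`not_refutableInDegree_glGOP'`);
* maximum degree `≤ d`, `3 ≤ d ≤ cr/4` ⇒ every Res(⊕) refutation (semantic weakening) of `GOP(G)`
  has a line of rank `≥ d` (`resLinWidth_glGOP'`, `le_minResLinWidth_glGOP'`);
* maximum degree `≤ t`, `3 ≤ t < d ≤ cr/4` ⇒ clause space `≥ d + 1 - t` (`clauseSpace_glGOP'`,
  Gryaznov–Ovcharov–Riazanov 2024 Cor. 2 in the tree's constants), tree-like size `≥ 2^(d-t-1)`
  (`treeLike_length_glGOP'`), and the quadratic dag-like law (`quadratic_length_glGOP'`).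

Not here: explicit families of bounded-degree vertex expanders (GL10 Thm 2 quotes a
`(n/2, 1/18)`-vertex expander family; none is constructed in the tree), GOR Thm 9 (the projection
`Ordering_n → GOP(G)`).

References: N. Galesi, M. Lauria, ACM ToCL 12(1) (2010), Thm 1; S. Gryaznov, S. Ovcharov,
A. Riazanov, ACM ToCT (2024), §4.1 (Thm 8, Cor. 2); K. Efremenko, M. Garlík, D. Itsykson,
STOC 2024, §1.1.1.
-/

noncomputable section

namespace Summit.PneNP.PneNP.Theorems

-- `Summit.PneNP.PneNP` repeats a path component by design (summit = sub-problem); silence the linter.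
set_option linter.dupNamespace false

open Literature.Computability.Complexity Literature.Computability.MetaComplexity
open Summit.PneNP.PneNP.Theorems.PolyCalc

namespace ResLinPC

variable {n : ℕ} (G : SimpleGraph (Fin n)) [DecidableRel G.Adj] {r : ℕ} {c : ℝ} {t d : ℕ}

/-- **GL10 Thm 1 over `𝔽₂`, unconditionally**: for an `(r, c)`-vertex expander (`r ≥ 1`, `c > 0`)
the clause polynomials of `GOP(G)` have no PC refutation of degree `≤ d ≤ cr/4`.
[Galesi–Lauria 2010, Thm 1 — proved in `GraphOrderingPrincipleDegreeProof.lean`] -/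
theorem not_refutableInDegree_glGOP' (hr : 1 ≤ r) (hc : 0 < c) (hG : IsVertexExpander G r c)
    (hd : (d : ℝ) ≤ c * r / 4) : ¬ PC.RefutableInDegree (cnfPolys (ZMod 2) (GOP.glGOP G)) d :=
  not_refutableInDegree_glGOP G GalesiLauria2010_PC_GOP_degree_holds hr hc hG hd

/-- **Res(⊕) rank of graph ordering principles, unconditionally**: over an `(r, c)`-vertex
expander of maximum degree `≤ d` with `3 ≤ d ≤ cr/4`, every Res(⊕) refutation of `GOP(G)`
contains a line of rank `≥ d`. [Gryaznov–Ovcharov–Riazanov 2024, §4.1; Galesi–Lauria 2010, Thm 1] -/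
theorem resLinWidth_glGOP' (hr : 1 ≤ r) (hc : 0 < c) (hG : IsVertexExpander G r c) (h3 : 3 ≤ d)
    (hdeg : ∀ u, G.degree u ≤ d) (hd : (d : ℝ) ≤ c * r / 4) {π : List ResLinLine}
    (hπ : IsResLinRefutation (GOP.glGOP G) π) : d ≤ resLinWidth π :=
  resLinWidth_glGOP G GalesiLauria2010_PC_GOP_degree_holds hr hc hG h3 hdeg hd hπ

/-- The same for the minimal refutation width (`ℕ∞`), unconditionally.
[Gryaznov–Ovcharov–Riazanov 2024, §4.1; Galesi–Lauria 2010, Thm 1] -/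
theorem le_minResLinWidth_glGOP' (hr : 1 ≤ r) (hc : 0 < c) (hG : IsVertexExpander G r c)
    (h3 : 3 ≤ d) (hdeg : ∀ u, G.degree u ≤ d) (hd : (d : ℝ) ≤ c * r / 4) :
    (d : ℕ∞) ≤ minResLinWidth (GOP.glGOP G) :=
  le_minResLinWidth_glGOP G GalesiLauria2010_PC_GOP_degree_holds hr hc hG h3 hdeg hd

/-- **Res(⊕) clause space of graph ordering principles, unconditionally** (GOR Cor. 2 in the
tree's constants): maximum degree `≤ t`, `3 ≤ t < d ≤ cr/4` ⇒ clause space `≥ d + 1 - t`.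
[Gryaznov–Ovcharov–Riazanov 2024, Cor. 2; Galesi–Lauria 2010, Thm 1] -/
theorem clauseSpace_glGOP' (hr : 1 ≤ r) (hc : 0 < c) (hG : IsVertexExpander G r c) (h3 : 3 ≤ t)
    (hdeg : ∀ u, G.degree u ≤ t) (htd : t + 1 ≤ d) (hd : (d : ℝ) ≤ c * r / 4)
    {ϖ : List (Finset LinClause)} (hϖ : IsResLinSpaceRefutation (GOP.glGOP G) ϖ) :
    d + 1 - t ≤ resLinClauseSpace ϖ :=
  clauseSpace_glGOP G GalesiLauria2010_PC_GOP_degree_holds hr hc hG h3 hdeg htd hd hϖ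

/-- **Tree-like Res(⊕) size of graph ordering principles, unconditionally**: maximum degree `≤ t`,
`3 ≤ t ≤ d ≤ cr/4` ⇒ every tree-like Res(⊕) refutation of `GOP(G)` has `≥ 2^(d - t - 1)` lines.
[Efremenko–Garlík–Itsykson 2024, §1.1.1; Galesi–Lauria 2010, Thm 1] -/
theorem treeLike_length_glGOP' (hr : 1 ≤ r) (hc : 0 < c) (hG : IsVertexExpander G r c)
    (h3 : 3 ≤ t) (hdeg : ∀ u, G.degree u ≤ t) (htd : t ≤ d) (hd : (d : ℝ) ≤ c * r / 4)
    {π : List ResLinLine} (hπ : IsResLinRefutation (GOP.glGOP G) π)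
    (htree : ∀ i : ℕ, (π.map fun l => l.premises.count i).sum ≤ 1) : 2 ^ (d - t - 1) ≤ π.length :=
  treeLike_length_glGOP G GalesiLauria2010_PC_GOP_degree_holds hr hc hG h3 hdeg htd hd hπ htree

/-- **Dag-like Res(⊕) size of graph ordering principles, quadratic law, unconditionally**:
`2 + (d-1)·d ≤ 2·|π| + t·(t+1)` for every Res(⊕) refutation `π` of `GOP(G)` (maximum degree
`≤ t`, `3 ≤ t < d ≤ cr/4`). [Galesi–Lauria 2010, Thm 1; the tree's quadratic law] -/
theorem quadratic_length_glGOP' (hr : 1 ≤ r) (hc : 0 < c) (hG : IsVertexExpander G r c)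
    (h3 : 3 ≤ t) (hdeg : ∀ u, G.degree u ≤ t) (htd : t + 1 ≤ d) (hd : (d : ℝ) ≤ c * r / 4)
    {π : List ResLinLine} (hπ : IsResLinRefutation (GOP.glGOP G) π) :
    2 + (d - 1) * d ≤ 2 * π.length + t * (t + 1) :=
  quadratic_length_glGOP G GalesiLauria2010_PC_GOP_degree_holds hr hc hG h3 hdeg htd hd hπ

end ResLinPC

end Summit.PneNP.PneNP.Theorems
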